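import Literature.Computability.AlgebraicComplexity.BILPS19MinrankInvarianceProofs
import HarnessLib

/-!
# BILPS Thm 21 (stabilizer of `T_{k,n,r}`), STEP 1 of the printed proof: the `U`-component of a
# stabilizer element is monomial with the first coordinate isolated

Partial proof file (theorem-only, 0 named facts) toward `BILPS2019_thm21` of
`BILPS19MinrankVarieties.lean` (Bläser–Ikenmeyer–Lysikov–Pandey–Schreyer, arXiv:1911.02534, Thm 21,
proof p0024:L12–24). Printed: "Let `(A, B, C) ∈ Stab T_{k,n,r}` … `(A ⊗ B ⊗ C) T = Σ_i e_i ⊗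
(B ⊗ C)(Σ_j a_{ij} T_j)`. Note that the rank of `Σ_j a_{ij} T_j` and, consequently, of the `i`-th
slice of `(A ⊗ B ⊗ C) T_{k,n,r}`, is equal to `s r + q n`, where `s = 0` if `a_{i1} = 0` and `s = 1`
otherwise, and `q` is the number of nonzero entries among `a_{i2}, …, a_{ik}`. Therefore, `A`
contains only one nonzero entry in each row, and in the first row the nonzero entry is in the first
column, otherwise the ranks of slices of `T_{k,n,r}` and `(A ⊗ B ⊗ C) T_{k,n,r}` do not match."

This file proves exactly that step, in the tree's coordinates (`bilpsTensor F k' n r`, slice index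
`Option (Fin k')` with `none` = the first coordinate, `L = F^r ⊕ (F^n)^{k'}` indexed by
`BIdx k' n r`): `rank_sum_smul_bilpsSlice` (the slice combination `Σ_{a'} c_{a'} T_{a'}` is the
diagonal matrix with entries `c none` on `F^r` and `c (some i)` on the `i`-th block `F^n`, of rank
`[c none ≠ 0]·r + n·#{i : c (some i) ≠ 0}`) and `BILPS2019_thm21_step1` (for `(A,B,C) ∈ Stab`,
`1 ≤ r < n`: `A none none ≠ 0`, `A none (some i) = 0`, `A (some i) none = 0`, and each row `some i`
has exactly one nonzero entry `A (some i) (some j)`). The remaining steps of the printed proof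
(`B` block diagonal via the "stabilizer of the identity" lemma, `C = B^{-T}` up to the scaling
`z`, assembly of `IsBILPSStabElement`) and the inclusion `⊇` are NOT proved here; the named fact
`BILPS2019_thm21` stays open. Valid over every field. Honest framing (val-lit, row X5-BILPS19):
nothing here bears on `VP ≠ VNP`, which is NOT proved.
-/

noncomputable section

namespace Literature.Computability.AlgebraicComplexity

open Matrix

section Thm21Step1

open scoped Classical

variable {F : Type*} [Field F] {k' n r : ℕ}

/-- A linear combination of the slices of `T_{k,n,r}` is the diagonal matrix with entry `c none` on
`F^r` and `c (some i)` on the `i`-th block `F^n` ("`Σ_j a_{ij} T_j`", p0024:L15).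
[cite: BlaserIkenmeyerLysikovPandeySchreyer2019, Thm. 21 (proof)] -/
theorem sum_smul_bilpsSlice_eq_diagonal (c : Option (Fin k') → F) :
    ∑ a', c a' • Matrix.of (bilpsTensor F k' n r a') =
      Matrix.diagonal (fun x : BIdx k' n r =>
        c (Sum.elim (fun _ => none) (fun q => some q.2) x)) := by
  ext x y
  rw [Matrix.sum_apply, Matrix.diagonal_apply, Fintype.sum_option]
  simp only [Matrix.smul_apply, Matrix.of_apply, smul_eq_mul]
  rcases x with j | ⟨j, i₁⟩ <;> rcases y with j' | ⟨j', i₂⟩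
  · simp only [bilpsTensor, Sum.elim_inl, Sum.inl.injEq, mul_ite, mul_one, mul_zero,
      Finset.sum_const_zero, add_zero]
  · simp [bilpsTensor]
  · simp [bilpsTensor]
  · simp only [bilpsTensor, mul_zero, zero_add, Sum.elim_inr, Sum.inr.injEq, Prod.mk.injEq]
    rw [Finset.sum_eq_single i₁ (fun i _ hi => by
        rw [if_neg (fun h => hi h.1.symm), mul_zero]) (fun h => absurd (Finset.mem_univ _) h)]
    by_cases h : j = j' ∧ i₁ = i₂
    · rw [if_pos h, if_pos ⟨rfl, h.2.symm, h.1⟩, mul_one]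
    · rw [if_neg h, if_neg (fun h' => h ⟨h'.2.2, h'.2.1.symm⟩), mul_zero]

/-- **Rank of a slice combination** ("the rank of `Σ_j a_{ij} T_j` … is equal to `s r + q n`",
p0024:L16–18): `rk(Σ_{a'} c_{a'} T_{a'}) = [c none ≠ 0]·r + n·#{i : c (some i) ≠ 0}`.
[cite: BlaserIkenmeyerLysikovPandeySchreyer2019, Thm. 21 (proof)] -/
theorem rank_sum_smul_bilpsSlice (c : Option (Fin k') → F) :
    (∑ a', c a' • Matrix.of (bilpsTensor F k' n r a')).rank =
      (if c none ≠ 0 then r else 0) +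
        n * (Finset.univ.filter (fun i : Fin k' => c (some i) ≠ 0)).card := by
  rw [sum_smul_bilpsSlice_eq_diagonal, Matrix.rank_diagonal, Fintype.card_subtype, Finset.card_filter,
    Fintype.sum_sum_type]
  simp only [Sum.elim_inl, Sum.elim_inr]
  congr 1
  · by_cases h0 : c none ≠ 0
    · simp [h0]
    · simp [h0]
  · rw [Fintype.sum_prod_type, Finset.card_filter, Finset.mul_sum, Finset.sum_comm]
    refine Finset.sum_congr rfl fun i _ => ?_
    by_cases hi : c (some i) ≠ 0
    · simp [hi]
    · simp [hi]

/-- The slices of `(A ⊗ B ⊗ C)·T` are `B · (Σ_{a'} A_{a a'} T_{a'}) · Cᵀ` ("`(A ⊗ B ⊗ C) T =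
Σ_i e_i ⊗ (B ⊗ C)(Σ_j a_{ij} T_j)`", p0024:L14).
[cite: BlaserIkenmeyerLysikovPandeySchreyer2019, Thm. 21 (proof)] -/
theorem actTensor_slice_eq_mul_sum_mul {ι κ μ : Type*} [Fintype ι] [Fintype κ] [Fintype μ]
    (A : Matrix ι ι F) (B : Matrix κ κ F) (C : Matrix μ μ F) (T : ι → κ → μ → F) (a : ι) :
    Matrix.of (actTensor A B C T a) = B * (∑ a', A a a' • Matrix.of (T a')) * Cᵀ := by
  rw [actTensor_slice, Matrix.mul_sum, Matrix.sum_mul]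
  refine Finset.sum_congr rfl fun a' _ => ?_
  rw [Matrix.mul_smul, Matrix.smul_mul]

/-- For a stabilizer element with `U`-component `A`, every slice combination `Σ_{a'} A_{a a'} T_{a'}`
has the rank of the slice `T_a` ("otherwise the ranks of slices … do not match", p0024:L19–20).
[cite: BlaserIkenmeyerLysikovPandeySchreyer2019, Thm. 21 (proof)] -/
theorem rank_rowCombination_eq_of_mem_stab3
    {g : GL (Option (Fin k')) F × GL (BIdx k' n r) F × GL (BIdx k' n r) F}
    (hg : g ∈ stab3 (bilpsTensor F k' n r)) {A : Option (Fin k') → Option (Fin k') → F}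
    (hA : ∀ a b, A a b = (g.1 : Matrix (Option (Fin k')) (Option (Fin k')) F) a b)
    (a : Option (Fin k')) :
    (if A a none ≠ 0 then r else 0) +
        n * (Finset.univ.filter (fun i : Fin k' => A a (some i) ≠ 0)).card =
      (if (a : Option (Fin k')) = none then r else 0) +
        n * (Finset.univ.filter (fun i : Fin k' => a = some i)).card := by
  have hslice : Matrix.of (actTensor (g.1 : Matrix (Option (Fin k')) (Option (Fin k')) F)
      (g.2.1 : Matrix (BIdx k' n r) (BIdx k' n r) F) (g.2.2 : Matrix (BIdx k' n r) (BIdx k' n r) F)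
      (bilpsTensor F k' n r) a) = Matrix.of (bilpsTensor F k' n r a) := by
    have h : actTensor (g.1 : Matrix (Option (Fin k')) (Option (Fin k')) F)
        (g.2.1 : Matrix (BIdx k' n r) (BIdx k' n r) F) (g.2.2 : Matrix (BIdx k' n r) (BIdx k' n r) F)
        (bilpsTensor F k' n r) = bilpsTensor F k' n r := hg
    rw [h]
  rw [actTensor_slice_eq_mul_sum_mul] at hslice
  have hsum : (∑ a', (g.1 : Matrix (Option (Fin k')) (Option (Fin k')) F) a a' •
      Matrix.of (bilpsTensor F k' n r a')) = ∑ a', A a a' • Matrix.of (bilpsTensor F k' n r a') :=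
    Finset.sum_congr rfl fun a' _ => by rw [hA]
  rw [hsum] at hslice
  have hB : IsUnit (g.2.1 : Matrix (BIdx k' n r) (BIdx k' n r) F).det :=
    (Matrix.isUnit_iff_isUnit_det _).1 g.2.1.isUnit
  have hC : IsUnit (g.2.2 : Matrix (BIdx k' n r) (BIdx k' n r) F)ᵀ.det := by
    rw [Matrix.det_transpose]
    exact (Matrix.isUnit_iff_isUnit_det _).1 g.2.2.isUnit
  have hrank := congrArg Matrix.rank hslice
  rw [Matrix.rank_mul_eq_left_of_isUnit_det _ _ hC, Matrix.rank_mul_eq_right_of_isUnit_det _ _ hB,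
    rank_sum_smul_bilpsSlice] at hrank
  -- the slice `T_a` itself is the combination with the indicator of `a`
  have hTa : Matrix.of (bilpsTensor F k' n r a) =
      ∑ a', (if a = a' then (1 : F) else 0) • Matrix.of (bilpsTensor F k' n r a') := by
    rw [Finset.sum_eq_single a (fun a' _ ha' => by rw [if_neg (Ne.symm ha'), zero_smul])
      (fun h => absurd (Finset.mem_univ a) h), if_pos rfl, one_smul]
  rw [hTa, rank_sum_smul_bilpsSlice] at hrank
  rw [hrank]
  have h1 : ((if a = none then (1 : F) else 0) ≠ 0) ↔ a = none := by
    by_cases ha : a = none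
    · simp [ha]
    · simp [ha]
  have h2 : ∀ i : Fin k', ((if a = some i then (1 : F) else 0) ≠ 0) ↔ a = some i := by
    intro i
    by_cases ha : a = some i
    · simp [ha]
    · simp [ha]
  simp only [h2]
  congr 1
  by_cases ha : a = none
  · rw [if_pos (h1.2 ha), if_pos ha]
  · rw [if_neg (fun h => ha (h1.1 h)), if_neg ha]

/-- **BILPS Thm 21, step 1 of the printed proof** ("`A` contains only one nonzero entry in each
row, and in the first row the nonzero entry is in the first column", p0024:L19–22), for
`1 ≤ r < n`: the first row of `A` is supported on the first column, the other rows avoid the first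
column and have exactly one nonzero entry each.
[cite: BlaserIkenmeyerLysikovPandeySchreyer2019, Thm. 21 (proof)] -/
theorem BILPS2019_thm21_step1 (hr : 1 ≤ r) (hrn : r < n)
    {g : GL (Option (Fin k')) F × GL (BIdx k' n r) F × GL (BIdx k' n r) F}
    (hg : g ∈ stab3 (bilpsTensor F k' n r)) :
    (g.1 : Matrix (Option (Fin k')) (Option (Fin k')) F) none none ≠ 0 ∧
      (∀ i : Fin k', (g.1 : Matrix (Option (Fin k')) (Option (Fin k')) F) none (some i) = 0) ∧
      (∀ i : Fin k', (g.1 : Matrix (Option (Fin k')) (Option (Fin k')) F) (some i) none = 0) ∧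
      (∀ i : Fin k', ∃! j : Fin k',
        (g.1 : Matrix (Option (Fin k')) (Option (Fin k')) F) (some i) (some j) ≠ 0) := by
  obtain ⟨A, hA⟩ : ∃ A : Option (Fin k') → Option (Fin k') → F,
      ∀ a b, A a b = (g.1 : Matrix (Option (Fin k')) (Option (Fin k')) F) a b := ⟨_, fun _ _ => rfl⟩
  simp only [← hA]
  have hrow := rank_rowCombination_eq_of_mem_stab3 hg hA
  -- first row: `s·r + n·q = r`
  have hnone := hrow none
  have hR0 : (Finset.univ.filter (fun i : Fin k' => (none : Option (Fin k')) = some i)).card = 0 := by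
    rw [Finset.card_eq_zero, Finset.filter_eq_empty_iff]
    intro i _ h
    exact Option.some_ne_none i h.symm
  rw [hR0, mul_zero, add_zero, if_pos rfl] at hnone
  have hq0 : (Finset.univ.filter (fun i : Fin k' => A none (some i) ≠ 0)).card = 0 := by
    by_contra hq
    have h1 : 1 ≤ (Finset.univ.filter (fun i : Fin k' => A none (some i) ≠ 0)).card := by omega
    have : n ≤ r := by
      calc n ≤ n * (Finset.univ.filter (fun i : Fin k' => A none (some i) ≠ 0)).card :=
            Nat.le_mul_of_pos_right n h1
        _ ≤ (if A none none ≠ 0 then r else 0) +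
            n * (Finset.univ.filter (fun i : Fin k' => A none (some i) ≠ 0)).card :=
            Nat.le_add_left _ _
        _ = r := hnone
    omega
  have h00 : A none none ≠ 0 := by
    intro h0
    rw [hq0, mul_zero, add_zero, if_neg (fun h => h h0)] at hnone
    omega
  -- other rows: `s·r + n·q = n`
  have hR1 : ∀ i : Fin k',
      (Finset.univ.filter (fun j : Fin k' => (some i : Option (Fin k')) = some j)).card = 1 := by
    intro i
    rw [Finset.card_eq_one]
    refine ⟨i, ?_⟩
    ext j
    simp [eq_comm]
  have hsome : ∀ i : Fin k', A (some i) none = 0 ∧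
      (Finset.univ.filter (fun j : Fin k' => A (some i) (some j) ≠ 0)).card = 1 := by
    intro i
    have h := hrow (some i)
    rw [hR1 i, mul_one, if_neg (Option.some_ne_none i), zero_add] at h
    have hn : 0 < n := by omega
    by_cases hi : A (some i) none = 0
    · rw [if_neg (fun h' => h' hi), zero_add] at h
      exact ⟨hi, Nat.eq_of_mul_eq_mul_left hn (by rw [h, mul_one])⟩
    · exfalso
      rw [if_pos hi] at h
      rcases Nat.eq_zero_or_pos
          (Finset.univ.filter (fun j : Fin k' => A (some i) (some j) ≠ 0)).card with h0 | hpos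
      · rw [h0, mul_zero, add_zero] at h
        omega
      · have : r + n ≤ n := by
          calc r + n ≤ r + n * (Finset.univ.filter
                (fun j : Fin k' => A (some i) (some j) ≠ 0)).card :=
              Nat.add_le_add_left (Nat.le_mul_of_pos_right n hpos) r
            _ = n := h
        omega
  refine ⟨h00, fun i => ?_, fun i => (hsome i).1, fun i => ?_⟩
  · by_contra hi
    have hmem : i ∈ Finset.univ.filter (fun i : Fin k' => A none (some i) ≠ 0) :=
      Finset.mem_filter.2 ⟨Finset.mem_univ _, hi⟩
    rw [Finset.card_eq_zero.1 hq0] at hmem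
    exact absurd hmem (Finset.notMem_empty _)
  · obtain ⟨j, hj⟩ := Finset.card_eq_one.1 (hsome i).2
    refine ⟨j, ?_, fun j' hj' => ?_⟩
    · have hmem : j ∈ Finset.univ.filter (fun j : Fin k' => A (some i) (some j) ≠ 0) := by
        rw [hj]
        exact Finset.mem_singleton_self j
      exact (Finset.mem_filter.1 hmem).2
    · have hmem : j' ∈ Finset.univ.filter (fun j : Fin k' => A (some i) (some j) ≠ 0) :=
        Finset.mem_filter.2 ⟨Finset.mem_univ _, hj'⟩
      rw [hj] at hmem
      exact Finset.mem_singleton.1 hmem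

end Thm21Step1

section Thm21Step1b

open scoped Classical

variable {F : Type*} [Field F] {k' n r : ℕ}

/-- **BILPS Thm 21, step 1b of the printed proof** ("Thus, `A` is a product of a diagonal matrix and
a permutation matrix corresponding to some permutation `σ` of the last `k − 1` coordinates of `F^k`",
p0024:L22–24): for `(A, B, C) ∈ Stab T_{k,n,r}` with `1 ≤ r < n`, the `U`-component is
`P_σ · diag(z)` with `σ` fixing the first coordinate — exactly the first conjunct of the tree's
`IsBILPSStabElement`. (Injectivity of the column pattern comes from the invertibility of `A`:
two rows supported on the same column give a kernel vector, `Matrix.exists_vecMul_eq_zero_iff`.)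
[cite: BlaserIkenmeyerLysikovPandeySchreyer2019, Thm. 21 (proof)] -/
theorem BILPS2019_thm21_step1b (hr : 1 ≤ r) (hrn : r < n)
    {g : GL (Option (Fin k')) F × GL (BIdx k' n r) F × GL (BIdx k' n r) F}
    (hg : g ∈ stab3 (bilpsTensor F k' n r)) :
    ∃ (σ : Equiv.Perm (Fin k')) (z : Option (Fin k') → Fˣ),
      (g.1 : Matrix (Option (Fin k')) (Option (Fin k')) F) =
        Equiv.Perm.permMatrix F (Equiv.optionCongr σ) * Matrix.diagonal (fun a => (z a : F)) := by
  obtain ⟨A, hA⟩ : ∃ A : Option (Fin k') → Option (Fin k') → F,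
      ∀ a b, A a b = (g.1 : Matrix (Option (Fin k')) (Option (Fin k')) F) a b := ⟨_, fun _ _ => rfl⟩
  obtain ⟨h00, hrow0, hcol0, huniq⟩ := BILPS2019_thm21_step1 hr hrn hg
  simp only [← hA] at h00 hrow0 hcol0 huniq
  -- the column pattern `f` of the rows `some i`
  choose f hf hfuniq using huniq
  have hzero : ∀ i j, j ≠ f i → A (some i) (some j) = 0 := by
    intro i j hj
    by_contra h
    exact hj (hfuniq i j h)
  -- `f` is injective, because `A` is invertible
  have hdet : (g.1 : Matrix (Option (Fin k')) (Option (Fin k')) F).det ≠ 0 :=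
    ((Matrix.isUnit_iff_isUnit_det _).1 g.1.isUnit).ne_zero
  have hfinj : Function.Injective f := by
    intro i i' hii'
    by_contra hne
    apply hdet
    rw [← Matrix.exists_vecMul_eq_zero_iff]
    refine ⟨fun a => if a = some i then A (some i') (some (f i)) else
      if a = some i' then -A (some i) (some (f i)) else 0, ?_, ?_⟩
    · intro hv
      have := congr_fun hv (some i)
      simp only [if_true, Pi.zero_apply] at this
      exact hf i' (hii' ▸ this)
    · funext b
      rw [Matrix.vecMul, dotProduct, Pi.zero_apply, Fintype.sum_option]
      simp only [reduceCtorEq, if_false, zero_mul, zero_add, Option.some.injEq]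
      rw [Finset.sum_eq_add_of_mem i i' (Finset.mem_univ _) (Finset.mem_univ _) hne]
      · simp only [if_true, if_neg (Ne.symm hne), ← hA]
        rcases b with _ | j
        · rw [hcol0 i, hcol0 i', mul_zero, mul_zero, add_zero]
        · by_cases hj : j = f i
          · subst hj
            rw [hii']
            ring
          · rw [hzero i j hj, hzero i' j (hii' ▸ hj), mul_zero, mul_zero, add_zero]
      · intro c _ hc
        rw [if_neg hc.1, if_neg hc.2, zero_mul]
  let σ : Equiv.Perm (Fin k') := Equiv.ofBijective f (Finite.injective_iff_bijective.1 hfinj)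
  have hσ : ∀ i, σ i = f i := fun i => rfl
  -- the diagonal entries
  have hzval : ∀ a : Option (Fin k'), A ((Equiv.optionCongr σ).symm a) a ≠ 0 := by
    intro a
    rcases a with _ | j
    · exact h00
    · have h := hf (σ.symm j)
      have e : f (σ.symm j) = j := by rw [← hσ, Equiv.apply_symm_apply]
      rw [e] at h
      exact h
  refine ⟨σ, fun a => Units.mk0 _ (hzval a), ?_⟩
  ext a b
  rw [PEquiv.toMatrix_mul_apply, Equiv.toPEquiv_apply]
  simp only [← hA, Matrix.diagonal_apply, Units.val_mk0]
  rcases a with _ | i <;> rcases b with _ | j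
  · rw [if_pos (show (Equiv.optionCongr σ) none = none from rfl), Equiv.symm_apply_apply]
    rfl
  · simp [hrow0 j]
  · simp [hcol0 i]
  · by_cases hj : σ i = j
    · subst hj
      rw [if_pos (show (Equiv.optionCongr σ) (some i) = some (σ i) from rfl),
        Equiv.symm_apply_apply]
      rfl
    · have h0 := hzero i j (fun h => hj (by rw [hσ, h]))
      simp [hj, h0]

end Thm21Step1b

end Literature.Computability.AlgebraicComplexity
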